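import Literature.Computability.Complexity.OccurrenceObstructionsBIP
import HarnessLib

/-!
# BIP Thm. 6.2 (the hook-like building blocks occur) from Prop. 7.3 (positivity of plethysms)

Topic `Literature/Computability/Complexity` (route Literature.PNP.no_occurrence_obstructions), conventions
of `OccurrenceObstructionsBIP.lean` (determinant size `m`, parameter `M`, `V = ℂ^{m×m}` with the
lexicographic matrix variables `MatIdx m`, `Ω_m = CplxAlg.orbitClosure (detFormLex ℂ m)`,
"λ occurs in `ℂ[Ω_m]`" = `HasHighestWeight (detOrbitRep ℂ m) (partitionWeightLex m λ)`,
`hookPartition b c i D = b × 1 + c × i + 1 × (D - b - ci)`, `topMatIdx m` = BIP's `e_1`).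

Source: P. Bürgisser, C. Ikenmeyer, G. Panova, *No occurrence obstructions in geometric complexity
theory*, J. AMS 32 (2019) = arXiv:1604.06431v3, §6(b) Thm. 6.2 and §7 (Claim 7.1, Props. 7.2,
7.3, Proof of Theorem 6.2). The BIP file keeps Thm. 6.2 ("Let `2 ≤ b, c ≤ m²` and let
`n ≥ 24m⁶`. Then there exists an even `i ≤ 2m⁴`, such that `λ = b × 1 + c × i + 1 × j` occurs in
`ℂ[Ω_n]_{3m⁴}` for `j = 3m⁴ n - b - ic`") as the named fact `bip2019_thm_6_2`. In print it is the
combination of a purely representation-theoretic positivity statement — Prop. 7.3, the explicit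
tableau constructions showing `a_ν(d[n]) > 0` for `ν = (t+1) × i + (r+1) × 1 + (j)` — with the
lifting machinery of §5–§6(a), all of which the tree already proves. This file

* vendors Prop. 7.3 as a named fact in the weight form of the topic (`bip2019_prop_7_3`), and
* PROVES Thm. 6.2 from it (`bip2019_thm_6_2_of_prop_7_3`), following the printed proof of
  Theorem 6.2 at the end of §7 (choice of the even `i`, `d = 3M⁴`, `N = 8M²`, Prop. 3.2,
  Thm. 2.5, Thm. 5.4),

so that, together with `Literature/Computability/Complexity/PlethysmStabilityBIP.lean`
(Props. 5.6(2), 5.8(2) discharged) and `Polarization.lean` (the BLMW lift discharged), BIP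
Thm. 1.4 rests on Prop. 7.3 alone; the corresponding assemblies with the remaining hypotheses
explicit are `bip2019_no_occurrence_obstructions_of_stability_of_prop_7_3` and
`no_occurrence_obstructions_succ_of_stability_of_prop_7_3`.

## References

* P. Bürgisser, C. Ikenmeyer, G. Panova, *No occurrence obstructions in geometric complexity
  theory*, J. AMS 32 (2019) = arXiv:1604.06431v3: §4 (`a_λ(d[n])`), Thm. 4.7, §5 Lemma 5.2,
  Lemma 5.3, Thm. 5.4, §6(b) Thm. 6.2, §7 Claim 7.1, Props. 7.2, 7.3 and the Proof of
  Theorem 6.2. [key `BurgisserIkenmeyerPanovaJAMS2019`]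

## Mathlib and tree

Mathlib: `Nat.lt_div_mul_add`, `Nat.div_mul_le_self`, `Nat.even_or_odd`, `Nat.sub_mul`,
`MvPolynomial` (`totalDegree_le_of_support_subset`, `IsHomogeneous.totalDegree`). Tree
(`OccurrenceObstructionsBIP.lean` and its imports): `hookPartition`/`hookRows`
(`ofPartition_partitionOfRows`, `antitone_hookRows`, `sum_range_hookRows`), `partitionWeightLex`,
`topMatIdx`/`le_topMatIdx`, `CplxAlg.innerLift` (`innerLift_mem_highestWeightSpace`,
`aeval_formCoeff_innerLift`, `aeval_formCoeff_iterPderiv_X_pow_mul`, `support_aeval_C_mul_X`,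
`descFactorial_add_pos`), `CplxAlg.exists_aeval_formCoeff_sum_linearFormPow_ne_zero`,
`CplxAlg.isHomogeneous_sum_linearFormPow`, `CplxAlg.X_pow_mul_sum_linearFormPow_mem_orbitClosure_detFormLex`,
`CplxAlg.aeval_formCoeff_eq_zero_of_mem_orbitClosure_detFormLex`,
`CplxAlg.hasHighestWeight_orbitCoordRep_of_not_mem`, `bip2019_no_occurrence_obstructions_of_stability'`,
`no_occurrence_obstructions_succ_of_stability'`. No new definitions besides the named fact.
-/

open MvPolynomial
open scoped BigOperators

namespace Literature.Computability.Complexity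

open Finset

section Hooks

/-- **BIP Prop. 7.3 (positivity of the plethysm coefficients of the hook-like shapes), as a
named fact in weight form.** Verbatim (arXiv v3): "7.3. Proposition. Let `t, r` be positive
integers, `i ∈ [(r+2t)²/(2t), (r+2t)²/(2t) + r + t + 1]`, and let `n > 6t + 2r` and
`d > r + 2t + i`. Let `ν = (t+1) × i + (r+1) × 1 + (j)`, where `j = dn - (r+1) - (t+1)i`. Then
`a_ν(d[n]) > 0`." Here `a_λ(d[n]) := dim HWV_λ(Sym^d Sym^n V)` (§4) for `V = ℂ^N` with at least
`ℓ(ν) = max(t, r) + 1` basis vectors (the tableau constructions of §7 use the variables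
`X_1, …, X_{ℓ(ν)}`); in the weight form of this topic (`V = ℂ^{N×N}`, `Sym^d Sym^n V` = the
forms of degree `d` on `Sym^n V^*`, i.e. of `ℂ[Sym^n] = MvPolynomial (DegIdx (MatIdx N) n) ℂ`,
highest weight `λ` ↔ `partitionWeightLex N λ`, as for Props. 5.6(2), 5.8(2), 2.4, 6.1 of
`OccurrenceObstructionsBIP.lean`): there is a NONZERO form of degree `d` in the highest-weight
space of weight `ν^*`, `ν = hookPartition (r+1) (t+1) i (d n)` (row lengths
`dn - r - ti = i + 1 + j`, then `1 + i` (`min(r,t)` times), …). The real interval condition on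
the integer `i` is written as `(r+2t)² ≤ 2t·i ≤ (r+2t)² + 2t(r+t+1)`. Printed proof: an explicit
tableau `T` of shape `ν` with content `d × n` and a monomial tensor `Φ` with `⟨v_T, Φ⟩ ≠ 0` by
the contraction rule Thm. 4.7 and Claim 7.1 (Prop. 7.2 for `r < t`).
[cite: BurgisserIkenmeyerPanovaJAMS2019, Prop. 7.3] -/
def bip2019_prop_7_3 : Prop :=
  ∀ (N t r i n d : ℕ) [NeZero N] (_ht : 0 < t) (_hr : 0 < r)
    (_hi₁ : (r + 2 * t) ^ 2 ≤ 2 * t * i) (_hi₂ : 2 * t * i ≤ (r + 2 * t) ^ 2 + 2 * t * (r + t + 1))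
    (_hn : 6 * t + 2 * r < n) (_hd : r + 2 * t + i < d) (_hN : max t r + 1 ≤ N * N),
    ∃ h : MvPolynomial (AlgebraicComplexity.DegIdx (Literature.NumberTheory.DiophantineGeometry.MatIdx N) n) ℂ, h ≠ 0 ∧ h.IsHomogeneous d ∧
      h ∈ Literature.NumberTheory.DiophantineGeometry.highestWeightSpace (AlgebraicComplexity.coordRep (Literature.NumberTheory.DiophantineGeometry.MatIdx N) ℂ n)
        (partitionWeightLex N (hookPartition (r + 1) (t + 1) i (d * n)))

/-- **The hook-like shapes of two sizes differ by first-row boxes**: for `b + ci ≤ D₁ ≤ D₂`,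
`(b×1 + c×i + 1×j₁)^* - (D₂ - D₁) ε_{top} = (b×1 + c×i + 1×j₂)^*` in the matrix/dual weight
convention (`D_k = b + ci + j_k`); i.e. the shape with `D₂` boxes is the `♯D₂`-lift of the one
with `D₁` boxes, the weight shift of the inner lifting (Lemma 5.3: "`κ` maps highest weight
vectors of weight `μ` to highest weight vectors of weight `μ♯dn`").
[cite: BurgisserIkenmeyerPanovaJAMS2019, Lemma 5.3 and Thm. 6.2 (proof, `λ = ν♯dn`)] -/
theorem partitionWeightLex_hookPartition_add_single (m : ℕ) [NeZero m] {b c i D₁ D₂ : ℕ}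
    (hb : 0 < b) (hc : 0 < c) (h₁ : b + c * i ≤ D₁) (h₁₂ : D₁ ≤ D₂) :
    partitionWeightLex m (hookPartition b c i D₁) + Pi.single (topMatIdx m) (-((D₂ - D₁ : ℕ) : ℤ)) =
      partitionWeightLex m (hookPartition b c i D₂) := by
  classical
  have h₂ : b + c * i ≤ D₂ := h₁.trans h₁₂
  funext x
  obtain ⟨j, rfl⟩ := (Literature.NumberTheory.DiophantineGeometry.matIdxEquiv m).surjective x
  rw [Pi.add_apply, partitionWeightLex, partitionWeightLex, Literature.NumberTheory.DiophantineGeometry.Weight.toMatIdx,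
    Literature.NumberTheory.DiophantineGeometry.Weight.toMatIdx, OrderIso.symm_apply_apply, Literature.NumberTheory.DiophantineGeometry.Weight.dualOfPartition,
    Literature.NumberTheory.DiophantineGeometry.Weight.dualOfPartition, Literature.NumberTheory.DiophantineGeometry.Weight.dual, Literature.NumberTheory.DiophantineGeometry.Weight.dual, hookPartition,
    hookPartition, ofPartition_partitionOfRows (antitone_hookRows hb hc h₁) (sum_range_hookRows hb hc h₁),
    ofPartition_partitionOfRows (antitone_hookRows hb hc h₂) (sum_range_hookRows hb hc h₂)]
  have htop : Literature.NumberTheory.DiophantineGeometry.matIdxEquiv m j = topMatIdx m ↔ ((Fin.rev j : Fin (m * m)) : ℕ) = 0 := by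
    rw [topMatIdx, (Literature.NumberTheory.DiophantineGeometry.matIdxEquiv m).injective.eq_iff, Fin.ext_iff, Fin.val_rev]
    have := j.2
    simp only
    omega
  have hmax : 0 < max b c := lt_max_of_lt_left hb
  by_cases h0 : ((Fin.rev j : Fin (m * m)) : ℕ) = 0
  · rw [htop.mpr h0, Pi.single_eq_same]
    simp only [h0, hmax, if_true, hookRows]
    have : (b - 1) + (c - 1) * i ≤ D₁ := by
      obtain ⟨b', rfl⟩ : ∃ b', b = b' + 1 := ⟨b - 1, by omega⟩
      obtain ⟨c', rfl⟩ : ∃ c', c = c' + 1 := ⟨c - 1, by omega⟩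
      simp only [Nat.add_sub_cancel]
      nlinarith
    have e1 : (D₁ - (b - 1) - (c - 1) * i : ℕ) + (D₂ - D₁) = D₂ - (b - 1) - (c - 1) * i := by omega
    rw [← e1]
    push_cast
    ring
  · rw [Pi.single_eq_of_ne (fun h' => h0 (htop.mp h')), add_zero]
    simp only [hookRows, h0, if_false]

/-- **BIP Thm. 6.2 PROVED from Prop. 7.3**, following the printed proof (end of §7): "We
apply Proposition 7.3 with `r = b - 1 ≤ m² - 1` and `t = c - 1 ≤ m² - 1`. We have
`(r+2t)²/(2t) ≤ m⁴` … We can then find an even integer `i` in the interval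
`[(r+2t)²/(2t), (r+2t)²/(2t) + r + t + 1] ⊆ [1, m⁴ + 2m²]`. By Proposition 7.3, there exists a
highest weight vector `f` of weight `ν = b × 1 + c × i + 1 × j'` in `Sym^d Sym^N V` for
`d := 3m⁴ > r + 2t + i`, `N := 8m² > 6t + 2r`. … By Proposition 3.2, we have
`⟨f, Δ_{N,n}(p)^d⟩ ≠ 0` for the power sum `p := φ_1^N + ⋯ + φ_d^N` and generic `φ_i ∈ V^*`.
Moreover, by Theorem 2.5, `q := X_1^{n-N} p` is contained in `Ω_n` for all `n ≥ dN`, in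
particular for `n ≥ 24m⁶`. Consider the lifting `h` of `f`; it has the weight `λ = ν♯dn` with
`dn = 3m⁴ n`. By Theorem 5.4 we have `⟨h, q^d⟩ = ⟨f, M^*(q)^d⟩ = ⟨f, Δ_{N,n}(p)^d⟩ ≠ 0`.
Therefore, `λ` occurs in `ℂ[Ω_n]_{3m⁴}`." Letters: determinant size `m` (BIP's `n`), parameter
`M` (BIP's `m`). Ingredients from the tree: the even `i` with `i ≤ 2M² (M²-1) + M² - 1 ≤ 2M⁴`
(elementary; the convexity bound `(r+2t)²/(2t) ≤ m⁴` of the print is replaced by the cruder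
`(A+2t)² ≤ 3A(A+2t)`, `A = M² - 1`, which suffices), Prop. 7.3 for `V = ℂ^{m×m}` (the named
fact), the dual inner lifting `innerLift` with its weight shift
(`CplxAlg.innerLift_mem_highestWeightSpace`, Lemma 5.3) and evaluation rule
(`CplxAlg.aeval_formCoeff_innerLift`, Thm. 5.4; `aeval_formCoeff_iterPderiv_X_pow_mul`, Lemma 5.2),
Prop. 3.2 (`CplxAlg.exists_aeval_formCoeff_sum_linearFormPow_ne_zero`), Thm. 2.5
(`CplxAlg.X_pow_mul_sum_linearFormPow_mem_orbitClosure_detFormLex`) and occurrence from a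
non-vanishing highest-weight vector (`CplxAlg.hasHighestWeight_orbitCoordRep_of_not_mem`).
[cite: BurgisserIkenmeyerPanovaJAMS2019, Thm. 6.2 and §7 (Proof of Theorem 6.2)] -/
theorem bip2019_thm_6_2_of_prop_7_3 (h73 : bip2019_prop_7_3) : bip2019_thm_6_2 := by
  intro m M b c _ hb hbM hc hcM hm
  classical
  have hm0 : m ≠ 0 := NeZero.ne m
  set iₘ := topMatIdx m with hiₘ'
  have hiₘ : ∀ i, i ≤ iₘ := le_topMatIdx m
  -- parameters `r = b - 1`, `t = c - 1`, `A = M² - 1`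
  obtain ⟨r, rfl⟩ : ∃ r, b = r + 1 := ⟨b - 1, by omega⟩
  obtain ⟨t, rfl⟩ : ∃ t, c = t + 1 := ⟨c - 1, by omega⟩
  have hr : 0 < r := by omega
  have ht : 0 < t := by omega
  have hM2 : 2 ≤ M := by
    by_contra hM
    have hM1 : M ≤ 1 := by omega
    have : M ^ 2 ≤ 1 ^ 2 := Nat.pow_le_pow_left hM1 2
    omega
  set A := M ^ 2 - 1 with hA
  have hM2A : M ^ 2 = A + 1 := by
    have : 1 ≤ M ^ 2 := Nat.one_le_pow _ _ (by omega)
    omega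
  have hA3 : 3 ≤ A := by
    have : 2 ^ 2 ≤ M ^ 2 := Nat.pow_le_pow_left hM2 2
    omega
  have hrA : r ≤ A := by omega
  have htA : t ≤ A := by omega
  have hM4 : M ^ 4 = A * A + 2 * A + 1 := by
    rw [show M ^ 4 = (M ^ 2) ^ 2 by ring, hM2A]; ring
  have hM6 : M ^ 6 = (A + 1) * (A * A + 2 * A + 1) := by
    rw [show M ^ 6 = M ^ 2 * (M ^ 2) ^ 2 by ring, hM2A]; ring
  -- the even `i` of the interval `[(r+2t)²/2t, (r+2t)²/2t + r + t + 1]`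
  set x := (r + 2 * t) ^ 2 with hx
  set i₀ := (x + 2 * t - 1) / (2 * t) with hi₀
  have h2t : 0 < 2 * t := by omega
  have hi₀₁ : x ≤ 2 * t * i₀ := by
    have h1 := Nat.lt_div_mul_add (a := x + 2 * t - 1) h2t
    rw [← hi₀, Nat.mul_comm i₀] at h1
    omega
  have hi₀₂ : 2 * t * i₀ + 1 ≤ x + 2 * t := by
    have h1 := Nat.div_mul_le_self (x + 2 * t - 1) (2 * t)
    rw [← hi₀, Nat.mul_comm i₀] at h1
    omega
  obtain ⟨i, hieven, hi₀i, hii₀⟩ : ∃ i, Even i ∧ i₀ ≤ i ∧ i ≤ i₀ + 1 := by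
    rcases Nat.even_or_odd i₀ with he | ho
    · exact ⟨i₀, he, le_rfl, Nat.le_succ _⟩
    · exact ⟨i₀ + 1, ho.add_one, Nat.le_succ _, le_rfl⟩
  have hQ₁ : 2 * t * i₀ ≤ 2 * t * i := Nat.mul_le_mul_left _ hi₀i
  have hQ₂ : 2 * t * i ≤ 2 * t * i₀ + 2 * t := by
    have := Nat.mul_le_mul_left (2 * t) hii₀
    rwa [Nat.mul_succ] at this
  have hi₁ : x ≤ 2 * t * i := hi₀₁.trans hQ₁
  have htt : 2 * t ≤ 2 * t * t := Nat.le_mul_of_pos_right _ ht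
  have hi₂ : 2 * t * i ≤ x + 2 * t * (r + t + 1) := by
    have hexp : 2 * t * (r + t + 1) = 2 * t * r + 2 * t * t + 2 * t := by ring
    have : 0 ≤ 2 * t * r := Nat.zero_le _
    omega
  -- `i ≤ 2A² + A`, whence `i ≤ 2M⁴` and `r + 2t + i < 3M⁴`
  have hxS : x ≤ A * A + 4 * (t * A) + 4 * (t * t) := by
    have h1 : x ≤ (A + 2 * t) ^ 2 := by rw [hx]; exact Nat.pow_le_pow_left (by omega) 2
    have h2 : (A + 2 * t) ^ 2 = A * A + 4 * (t * A) + 4 * (t * t) := by ring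
    omega
  have hF1 : t * t ≤ t * A := Nat.mul_le_mul_left t htA
  have hF2 : 3 * (t * A) ≤ t * (A * A) := by
    have h1 : t * A * 3 ≤ t * A * A := Nat.mul_le_mul_left (t * A) hA3
    have h2 : t * (A * A) = t * A * A := by ring
    omega
  have hF3 : A * A ≤ t * (A * A) := Nat.le_mul_of_pos_left _ ht
  have hF4 : t * 3 ≤ t * A := Nat.mul_le_mul_left t hA3
  have hxb : x + 2 * t ≤ 4 * (t * (A * A)) + 2 * (t * A) := by omega
  have hiA : i ≤ 2 * (A * A) + A := by
    have h1 : 2 * t * i < 2 * t * (2 * (A * A) + A + 1) := by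
      have hexp : 2 * t * (2 * (A * A) + A + 1) = 4 * (t * (A * A)) + 2 * (t * A) + 2 * t := by ring
      omega
    have := Nat.lt_of_mul_lt_mul_left h1
    omega
  have hi2M : i ≤ 2 * M ^ 4 := by rw [hM4]; omega
  have hd : r + 2 * t + i < 3 * M ^ 4 := by rw [hM4]; omega
  refine ⟨i, hieven, hi2M, ?_⟩
  -- Prop. 7.3 with `V = ℂ^{m×m}`, inner degree `8M²`, degree `3M⁴`
  have hn' : 6 * t + 2 * r < 8 * M ^ 2 := by rw [hM2A]; omega
  have hN : max t r + 1 ≤ m * m := by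
    have h1 : max t r + 1 ≤ M ^ 2 := by rw [hM2A]; omega
    have h2 : M ^ 2 ≤ 24 * M ^ 6 := by rw [hM2A, hM6]; nlinarith
    exact h1.trans (h2.trans (hm.trans (Nat.le_mul_self m)))
  obtain ⟨f, hf0, hfd, hfw⟩ := h73 m t r i (8 * M ^ 2) (3 * M ^ 4) ht hr hi₁ hi₂ hn' hd hN
  -- lift from inner degree `8M²` to `m` (BIP §7, last paragraph; as in §6(a))
  have hprod : 8 * M ^ 2 * (3 * M ^ 4) = 24 * M ^ 6 := by ring
  have hn'dm : 8 * M ^ 2 * (3 * M ^ 4) ≤ m := hprod ▸ hm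
  have hdpos : 0 < 3 * M ^ 4 := by positivity
  have hn'pos : 0 < 8 * M ^ 2 := by positivity
  have hn'm : 8 * M ^ 2 ≤ m := le_trans (Nat.le_mul_of_pos_right _ hdpos) hn'dm
  have hlift := AlgebraicComplexity.innerLift_mem_highestWeightSpace iₘ hiₘ hn'm hfd hfw
  have hbc : r + 1 + (t + 1) * i ≤ 3 * M ^ 4 * (8 * M ^ 2) := by
    have h1 : (t + 1) * i ≤ M ^ 2 * (2 * M ^ 4) := Nat.mul_le_mul hcM hi2M
    have h2 : M ^ 2 * (2 * M ^ 4) = 2 * M ^ 6 := by ring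
    have h3 : 3 * M ^ 4 * (8 * M ^ 2) = 24 * M ^ 6 := by ring
    have h4 : M ^ 2 ≤ M ^ 6 := Nat.pow_le_pow_right (by omega) (by norm_num)
    rw [h3]
    omega
  have hDD : 3 * M ^ 4 * (8 * M ^ 2) ≤ 3 * M ^ 4 * m := Nat.mul_le_mul_left _ hn'm
  have hw := partitionWeightLex_hookPartition_add_single m (Nat.succ_pos r) (Nat.succ_pos t) hbc hDD
  have hsub : 3 * M ^ 4 * m - 3 * M ^ 4 * (8 * M ^ 2) = (m - 8 * M ^ 2) * (3 * M ^ 4) := by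
    rw [Nat.sub_mul, Nat.mul_comm m, Nat.mul_comm (8 * M ^ 2)]
  rw [hsub] at hw
  rw [hw] at hlift
  refine Complexity.hasHighestWeight_orbitCoordRep_of_not_mem (Literature.NumberTheory.DiophantineGeometry.detFormLex ℂ m) m hlift ?_
  -- nonvanishing on `Ω_m`: evaluate the lifted vector at a padded power sum
  obtain ⟨F, hF⟩ : ∃ F : MvPolynomial (AlgebraicComplexity.DegIdx (Literature.NumberTheory.DiophantineGeometry.MatIdx m) (8 * M ^ 2)) ℂ,
      F = aeval (fun e : AlgebraicComplexity.DegIdx (Literature.NumberTheory.DiophantineGeometry.MatIdx m) (8 * M ^ 2) =>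
        C (((e.1 iₘ + (m - 8 * M ^ 2)).descFactorial (m - 8 * M ^ 2) : ℕ) : ℂ) * X e) f := ⟨_, rfl⟩
  have hsupp := AlgebraicComplexity.support_aeval_C_mul_X
    (fun e : AlgebraicComplexity.DegIdx (Literature.NumberTheory.DiophantineGeometry.MatIdx m) (8 * M ^ 2) =>
      (((e.1 iₘ + (m - 8 * M ^ 2)).descFactorial (m - 8 * M ^ 2) : ℕ) : ℂ))
    (fun e => Nat.cast_ne_zero.mpr (AlgebraicComplexity.descFactorial_add_pos _ _).ne') f
  rw [← hF] at hsupp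
  have hF0 : F ≠ 0 := by
    intro h0
    apply hf0
    rw [← support_eq_empty, ← hsupp, h0, support_zero]
  have hFdeg : F.totalDegree ≤ 3 * M ^ 4 :=
    (totalDegree_le_of_support_subset hsupp.le).trans (hfd.totalDegree hf0).le
  obtain ⟨φ, hφ⟩ := AlgebraicComplexity.exists_aeval_formCoeff_sum_linearFormPow_ne_zero hn'pos F hF0 hFdeg
  obtain ⟨p, hp⟩ : ∃ p : MvPolynomial (Literature.NumberTheory.DiophantineGeometry.MatIdx m) ℂ,
      p = ∑ j, (∑ x, C (φ j x) * X x) ^ (8 * M ^ 2) := ⟨_, rfl⟩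
  have hphom : p.IsHomogeneous (8 * M ^ 2) := by
    rw [hp]
    exact Complexity.isHomogeneous_sum_linearFormPow φ (8 * M ^ 2)
  obtain ⟨q, hq⟩ : ∃ q : MvPolynomial (Literature.NumberTheory.DiophantineGeometry.MatIdx m) ℂ, q = X iₘ ^ (m - 8 * M ^ 2) * p :=
    ⟨_, rfl⟩
  have hqhom : q.IsHomogeneous m := by
    have := (isHomogeneous_X_pow (R := ℂ) iₘ (m - 8 * M ^ 2)).mul hphom
    rwa [Nat.sub_add_cancel hn'm, ← hq] at this
  have hqmem : q ∈ AlgebraicComplexity.orbitClosure (Literature.NumberTheory.DiophantineGeometry.detFormLex ℂ m) := by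
    rw [hq, hp]
    exact Complexity.X_pow_mul_sum_linearFormPow_mem_orbitClosure_detFormLex (s := 8 * M ^ 2)
      (r := 3 * M ^ 4) hn'dm iₘ φ
  have hvq : aeval (AlgebraicComplexity.formCoeff m q) (AlgebraicComplexity.innerLift iₘ (8 * M ^ 2) m f) ≠ 0 := by
    rw [AlgebraicComplexity.aeval_formCoeff_innerLift iₘ hqhom, hq,
      AlgebraicComplexity.aeval_formCoeff_iterPderiv_X_pow_mul iₘ (m - 8 * M ^ 2) hphom, ← hF, hp]
    exact hφ
  intro hvI
  exact hvq (Complexity.aeval_formCoeff_eq_zero_of_mem_orbitClosure_detFormLex hqmem hvI)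

/-- **BIP Thm. 1.4 (BIP padding) from Props. 5.6(2), 5.8(2), 7.3 and the BLMW lift**
(`bip2019_no_occurrence_obstructions_of_stability'` with Thm. 6.2 discharged from Prop. 7.3).
[cite: BurgisserIkenmeyerPanovaJAMS2019, Thm. 1.4 and §6 (Proof of Theorem 1.4)] -/
theorem bip2019_no_occurrence_obstructions_of_stability_of_prop_7_3 (h562 : bip2019_prop_5_6_2)
    (h582 : bip2019_prop_5_8_2) (h73 : bip2019_prop_7_3)
    (hlift : ∀ m : ℕ,
      Literature.NumberTheory.DiophantineGeometry.hasHighestWeight_coordRep_of_orbitCoordRep (k := ℂ) (σ := Literature.NumberTheory.DiophantineGeometry.MatIdx m)) :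
    bip2019_no_occurrence_obstructions :=
  bip2019_no_occurrence_obstructions_of_stability' h562 h582 (bip2019_thm_6_2_of_prop_7_3 h73) hlift

/-- **The fresh-variable statement at threshold `(n+1)^25` from Props. 5.6(2), 5.8(2), 7.3 and
the BLMW lift.** [cite: BurgisserIkenmeyerPanovaJAMS2019, §6 (Proof of Theorem 1.4), with M = n + 1] -/
theorem no_occurrence_obstructions_succ_of_stability_of_prop_7_3 (h562 : bip2019_prop_5_6_2)
    (h582 : bip2019_prop_5_8_2) (h73 : bip2019_prop_7_3)
    (hlift : ∀ m : ℕ,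
      Literature.NumberTheory.DiophantineGeometry.hasHighestWeight_coordRep_of_orbitCoordRep (k := ℂ) (σ := Literature.NumberTheory.DiophantineGeometry.MatIdx m)) :
    no_occurrence_obstructions_succ :=
  no_occurrence_obstructions_succ_of_stability' h562 h582 (bip2019_thm_6_2_of_prop_7_3 h73) hlift

end Hooks

end Literature.Computability.Complexity
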